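import Literature.AnabelianGeometry.AbsoluteAnabelian.AbsTopICuspidalDecompositionSub
import HarnessLib

/-!
# [AbsTopI] Lemma 4.5 SUB-DAG — sub-node A10 `τ(Hom(V, ℚ_l)) = τ(V)`, PROVED

Proof-only companion (abc-iut cell, layer L4, seat abc-iut-w5-d062) of
`AbsTopICuspidalDecompositionSub.lean` (table `plan/L4/SUBDAG-AbsTopI-Lem45.md`, row A10): for a
finite-dimensional `G`-module `V` over a field, the quasi-trivial rank of the dual representation
`Hom_K(V, K)` equals that of `V` — annihilator (resp. coannihilator) chains carry stable chains of `V`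
(resp. of the dual) to stable chains of the dual (resp. of `V`), reversing the order, matching
quasi-trivial steps and their dimensions.  This is the identification behind reading
`d_χ(M) = τ(M(χ⁻¹)) − τ(Hom(M, ℚ_l))` ([AbsTopI] Lemma 4.5 (ii) p. 54) as "weight-2 rank minus
weight-0 rank" ([CombGC] proof of Cor. 2.7 (i) p. 23).  Mathlib only (`Submodule.dualAnnihilator`,
`dualCoannihilator`, `Subspace.finrank_add_finrank_dual(Co)annihilator_eq`); no `def`s (the two chain constructions live inside the existence proofs).
HONEST FRAMING: refereed pre-IUT anabelian geometry; nothing here bears on [IUTchIII] Cor. 3.12.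
-/

noncomputable section

open scoped Classical

namespace Literature.AnabelianGeometry.AbsoluteAnabelian.AbsTopI

universe u v w

/-! ### SUB-NODE A10: `τ(Hom(V, ℚ_l)) = τ(V)` via (co)annihilator chains -/


section DualRankProofs

variable {G : Type u} [Group G] [TopologicalSpace G]
variable {K : Type v} [Field K] {M : Type w} [AddCommGroup M] [Module K M]

omit [TopologicalSpace G] in
/-- The dual action, evaluated. [cite: MochizukiAbsTopI2012, Lemma 4.5 (ii) p.54] -/
theorem dualRep_apply (ρ : G →* (M ≃ₗ[K] M)) (g : G) (φ : Module.Dual K M) (x : M) :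
    dualRep ρ g φ x = φ (ρ g⁻¹ x) := rfl

omit [TopologicalSpace G] in
/-- Annihilators of stable submodules are stable under the dual action.
[cite: MochizukiAbsTopI2012, Lemma 4.5 (ii) p.54] -/
theorem isStable_dualAnnihilator (ρ : G →* (M ≃ₗ[K] M)) {N : Submodule K M} (hN : IsStable ρ N) :
    IsStable (dualRep ρ) N.dualAnnihilator := by
  intro g φ hφ
  rw [Submodule.mem_dualAnnihilator] at hφ ⊢
  intro w hw
  rw [dualRep_apply]
  exact hφ _ (hN g⁻¹ w hw)

omit [TopologicalSpace G] in
/-- Coannihilators of stable submodules of the dual are stable. [cite: MochizukiAbsTopI2012, Lemma 4.5 (ii) p.54] -/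
theorem isStable_dualCoannihilator (ρ : G →* (M ≃ₗ[K] M)) {Φ : Submodule K (Module.Dual K M)}
    (hΦ : IsStable (dualRep ρ) Φ) : IsStable ρ Φ.dualCoannihilator := by
  intro g x hx
  rw [Submodule.mem_dualCoannihilator] at hx ⊢
  intro φ hφ
  have h := hx _ (hΦ g⁻¹ φ hφ)
  rwa [dualRep_apply, inv_inv] at h

/-- A quasi-trivial step dualises to a quasi-trivial step (same open subgroup).
[cite: MochizukiAbsTopI2012, Lemma 4.5 (ii) p.54] -/
theorem isQuasiTrivialStep_dualAnnihilator (ρ : G →* (M ≃ₗ[K] M)) {N N' : Submodule K M}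
    (h : IsQuasiTrivialStep ρ N N') :
    IsQuasiTrivialStep (dualRep ρ) N'.dualAnnihilator N.dualAnnihilator := by
  obtain ⟨U, hU, hfi, hact⟩ := h
  refine ⟨U, hU, hfi, fun g hg φ hφ => ?_⟩
  rw [Submodule.mem_dualAnnihilator] at hφ ⊢
  intro w hw
  rw [LinearMap.sub_apply, dualRep_apply, ← map_sub]
  exact hφ _ (hact g⁻¹ (U.inv_mem hg) w hw)

/-- Dually for coannihilators. [cite: MochizukiAbsTopI2012, Lemma 4.5 (ii) p.54] -/
theorem isQuasiTrivialStep_dualCoannihilator (ρ : G →* (M ≃ₗ[K] M))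
    {Φ Φ' : Submodule K (Module.Dual K M)} (h : IsQuasiTrivialStep (dualRep ρ) Φ Φ') :
    IsQuasiTrivialStep ρ Φ'.dualCoannihilator Φ.dualCoannihilator := by
  obtain ⟨U, hU, hfi, hact⟩ := h
  refine ⟨U, hU, hfi, fun g hg x hx => ?_⟩
  rw [Submodule.mem_dualCoannihilator] at hx ⊢
  intro φ hφ
  have h := hx _ (hact g⁻¹ (U.inv_mem hg) φ hφ)
  rwa [LinearMap.sub_apply, dualRep_apply, inv_inv, ← map_sub] at h

variable (ρ : G →* (M ≃ₗ[K] M)) [FiniteDimensional K M]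

/-- For every stable chain of `V` there is a stable chain of the dual (the reversed annihilator chain)
with at least the same quasi-trivial dimension. [cite: MochizukiAbsTopI2012, Lemma 4.5 (ii) p.54] -/
theorem StableChain.exists_dual_qtDim_le {ρ : G →* (M ≃ₗ[K] M)} (c : StableChain ρ) :
    ∃ c' : StableChain (dualRep ρ), c.qtDim ≤ c'.qtDim := by
  let c' : StableChain (dualRep ρ) :=
    { length := c.length
      term := fun j => (c.term (c.length - j)).dualAnnihilator
      term_zero := by rw [Nat.sub_zero, c.term_length, Submodule.dualAnnihilator_bot]
      term_length := by rw [Nat.sub_self, c.term_zero, Submodule.dualAnnihilator_top]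
      step_le := fun j hj => by
        apply Submodule.dualAnnihilator_anti
        have h := c.step_le (c.length - (j + 1)) (by omega)
        rwa [show c.length - (j + 1) + 1 = c.length - j by omega] at h
      stable := fun j => isStable_dualAnnihilator ρ (c.stable _) }
  refine ⟨c', ?_⟩
  unfold StableChain.qtDim
  have hlen : c'.length = c.length := rfl
  rw [hlen]
  rw [← Finset.sum_range_reflect (fun i =>
    if IsQuasiTrivialStep (dualRep ρ) (c'.term i) (c'.term (i + 1)) then
      Module.finrank K (c'.term i) - Module.finrank K (c'.term (i + 1)) else 0)
    c.length]
  refine Finset.sum_le_sum fun j hj => ?_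
  rw [Finset.mem_range] at hj
  have e1 : c'.term (c.length - 1 - j) = (c.term (j + 1)).dualAnnihilator := by
    show (c.term (c.length - (c.length - 1 - j))).dualAnnihilator = _
    rw [show c.length - (c.length - 1 - j) = j + 1 by omega]
  have e2 : c'.term (c.length - 1 - j + 1) = (c.term j).dualAnnihilator := by
    show (c.term (c.length - (c.length - 1 - j + 1))).dualAnnihilator = _
    rw [show c.length - (c.length - 1 - j + 1) = j by omega]
  rw [e1, e2]
  by_cases hq : IsQuasiTrivialStep ρ (c.term j) (c.term (j + 1))
  · rw [if_pos hq, if_pos (isQuasiTrivialStep_dualAnnihilator ρ hq)]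
    have h1 := Subspace.finrank_add_finrank_dualAnnihilator_eq (c.term j)
    have h2 := Subspace.finrank_add_finrank_dualAnnihilator_eq (c.term (j + 1))
    omega
  · rw [if_neg hq]
    exact Nat.zero_le _

/-- Dually: for every stable chain of the dual there is a stable chain of `V` (the reversed
coannihilator chain) with at least the same quasi-trivial dimension.
[cite: MochizukiAbsTopI2012, Lemma 4.5 (ii) p.54] -/
theorem StableChain.exists_codual_qtDim_le {ρ : G →* (M ≃ₗ[K] M)} (c : StableChain (dualRep ρ)) :
    ∃ c' : StableChain ρ, c.qtDim ≤ c'.qtDim := by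
  let c' : StableChain ρ :=
    { length := c.length
      term := fun j => (c.term (c.length - j)).dualCoannihilator
      term_zero := by rw [Nat.sub_zero, c.term_length, Submodule.dualCoannihilator_bot]
      term_length := by rw [Nat.sub_self, c.term_zero, Submodule.dualCoannihilator_top]
      step_le := fun j hj => by
        apply Submodule.dualCoannihilator_anti
        have h := c.step_le (c.length - (j + 1)) (by omega)
        rwa [show c.length - (j + 1) + 1 = c.length - j by omega] at h
      stable := fun j => isStable_dualCoannihilator ρ (c.stable _) }
  refine ⟨c', ?_⟩
  unfold StableChain.qtDim
  have hlen : c'.length = c.length := rfl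
  rw [hlen]
  rw [← Finset.sum_range_reflect (fun i =>
    if IsQuasiTrivialStep ρ (c'.term i) (c'.term (i + 1)) then
      Module.finrank K (c'.term i) - Module.finrank K (c'.term (i + 1)) else 0)
    c.length]
  refine Finset.sum_le_sum fun j hj => ?_
  rw [Finset.mem_range] at hj
  have e1 : c'.term (c.length - 1 - j) = (c.term (j + 1)).dualCoannihilator := by
    show (c.term (c.length - (c.length - 1 - j))).dualCoannihilator = _
    rw [show c.length - (c.length - 1 - j) = j + 1 by omega]
  have e2 : c'.term (c.length - 1 - j + 1) = (c.term j).dualCoannihilator := by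
    show (c.term (c.length - (c.length - 1 - j + 1))).dualCoannihilator = _
    rw [show c.length - (c.length - 1 - j + 1) = j by omega]
  rw [e1, e2]
  by_cases hq : IsQuasiTrivialStep (dualRep ρ) (c.term j) (c.term (j + 1))
  · rw [if_pos hq, if_pos (isQuasiTrivialStep_dualCoannihilator ρ hq)]
    have h1 := Subspace.finrank_add_finrank_dualCoannihilator_eq (c.term j)
    have h2 := Subspace.finrank_add_finrank_dualCoannihilator_eq (c.term (j + 1))
    omega
  · rw [if_neg hq]
    exact Nat.zero_le _

/-- **SUB-NODE A10, PROVED**: `τ(Hom_K(V, K)) = τ(V)` for a finite-dimensional `G`-module `V`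
(annihilator / coannihilator chains carry quasi-trivial steps to quasi-trivial steps of the same
dimension). [cite: MochizukiAbsTopI2012, Lemma 4.5 (ii) p.54] [cite: MochizukiCombGC2007, Cor. 2.7 (i) proof p.23] -/
theorem dualRankEq_holds : DualRankEq ρ := by
  unfold DualRankEq
  apply le_antisymm
  · refine csSup_le ⟨_, ⟨StableChain.trivial (dualRep ρ), rfl⟩⟩ ?_
    rintro _ ⟨c, rfl⟩
    obtain ⟨c', hc'⟩ := c.exists_codual_qtDim_le
    exact hc'.trans c'.qtDim_le_quasiTrivialRank
  · refine csSup_le ⟨_, ⟨StableChain.trivial ρ, rfl⟩⟩ ?_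
    rintro _ ⟨c, rfl⟩
    obtain ⟨c', hc'⟩ := c.exists_dual_qtDim_le
    exact hc'.trans c'.qtDim_le_quasiTrivialRank

end DualRankProofs

end Literature.AnabelianGeometry.AbsoluteAnabelian.AbsTopI

end
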